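import Summits.HubbardSuperconductivity.HubbardSuperconductivity.Theorems.KLProgrammeKLRegimeScaleZeroCovarianceFarL2Images

/-!
# Route `KLProgramme`, crux K3 — engine-flow child (stmt-HubbardSuperconductivity-20437), stub (C) at `n = 0`, located item #22a «(C)-SCALE0-PT2»,
# the FAR-SITE supplier, LOW shell («(2e)-LOW-SHELL-PLANCHEREL», route of record (R221)) — companion of `…ScaleZeroCovarianceFarL2Images`:
# `k = 1` BY CAUCHY–SCHWARZ, and THE BARE-FRAME INSTANCE in the `hΦ` shape of `…SunsetFarRowsL2.farRows_le_of_l2Far`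

Cell gate-hubbard-kl, seat p1 g22 (supplier; the cert predicate, the kit and the closer are the k3c5 lineage's).
* §3b `tsum_far_weightOne_le_sqrt` — for a nonnegative lattice weight `P` (the far indicator): `Σ P·√(z₀²+z₁²)·‖a‖² ≤ √(Σ P‖a‖²)·√(Σ P(z₀²+z₁²)‖a‖²)`
  (termwise AM–GM `√r ≤ (t + r/t)/2` for every `t > 0`, then the optimal `t`): the `k = 1` certificate is `D₁ := √(D₀·D₂)`;
* §5 **`l2Far_low_of_farLattice`** — the bare-frame scale-`0` symbol (`Ψ¹`, `Λ = klE0`, `K = 0`, `ω ≠ 0`), in EXACTLY the `hΦ` shape of `farRows_le_of_l2Far`: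
  far weight `[z ≠ 0 ∧ z ∉ c.disk]·√(z₀²+z₁²)ᵏ`, hypothesis `Σ_z far-weight·‖a_ω(z)‖² ≤ D` (the certificate's business: by §3 of the companion it is
  `total − near`, or `near(R_tot) − near(Rc) +` an analytic tail), images constant HYPOTHESIS-FREE from the table-free bare jets
  (`norm_iteratedFDeriv_uvSpatialSymbol_bare_le_of_one_le_tab` ⇒ `norm_mFourierCoeff_descend_le_inv_pow_of_ne_zero` ⇒ `images_tail_le_of_decay`):
  `≤ (√D + √(L^{k+2})·(C_K(ω)/π^K)·(4/L)ᴷ·S_K)²`, `C_K(ω) = K!·klChi2CauchyTab K·(K+1)!·(2/m)²·max(1,2/m)^{K−1}·(8π)ᴷ`, `m = max(|ω|, klE0/2) ≥ 1/64`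
  (so `C_K(ω)` is bounded UNIFORMLY in `ω`), `S_K = Σ_{n ∈ ℤ²}(1+‖n‖∞)^{−K}` — at `L ≥ klEngL₃ β U`, `K = 4`, the second summand is astronomically small;
  `l2Far_low_of_farLattice_of_images` is the same with an abstract images bound `τ`.

Proofs only; no definitions; nothing here asserts (C), any stub of 20437, K3 or superconductivity; the far lattice sum bound `D` is a HYPOTHESIS (kit-certified
envelope, never discharged in Lean).  References: BGM 2006 §2.2 footnote 1, §3 (3.2) [cite: BenfattoGiulianiMastropietro2006]; Glimm–Jaffe 1987 Prop. 7.3.1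
[cite: GlimmJaffeQP1987]; Grafakos 2014 Prop. 3.2.6 (8), Prop. 3.2.7 (3), Thm. 3.3.9 [cite: Grafakos2014].
-/

noncomputable section

namespace Summit.HubbardSuperconductivity.HubbardSuperconductivity.Theorems.KLRegimeSplit

set_option linter.dupNamespace false -- summit = problem name (single-conjunct summit), D-0017

open Literature.MathematicalPhysics.QuantumLattice Literature.Probability.LatticeModels Literature.Analysis.FunctionSpaces
open Literature.Analysis.Fourier
open Summit.HubbardSuperconductivity.HubbardSuperconductivity.Theorems.DispersionFlow
open MeasureTheory Finset Complex UnitAddTorus Real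
open scoped Nat

variable {L : ℕ} [NeZero L]

/-! ## §3b `k = 1` by Cauchy–Schwarz of the two far sums -/

omit [NeZero L] in
/-- AM–GM for the middle weight: `√r ≤ (t + r/t)/2` for `r ≥ 0`, `t > 0`. -/
theorem sqrt_le_half_add_div {r t : ℝ} (hr : 0 ≤ r) (ht : 0 < t) : Real.sqrt r ≤ (t + r / t) / 2 := by
  have hs := Real.sqrt_nonneg r
  have hsq := Real.sq_sqrt hr
  rw [le_div_iff₀ (by norm_num : (0:ℝ) < 2), ← sub_nonneg]
  have : t + r / t - Real.sqrt r * 2 = (Real.sqrt r - t) ^ 2 / t := by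
    field_simp
    nlinarith
  rw [this]
  positivity

omit [NeZero L] in
/-- From `x ≤ (t·a + b/t)/2` for every `t > 0` (`a, b ≥ 0`) conclude `x ≤ √(a·b)`. -/
theorem le_sqrt_mul_of_forall_pos {x a b : ℝ} (ha : 0 ≤ a) (hb : 0 ≤ b) (h : ∀ t : ℝ, 0 < t → x ≤ (t * a + b / t) / 2) :
    x ≤ Real.sqrt (a * b) := by
  rcases ha.eq_or_lt with rfl | ha'
  · -- `a = 0`: `x ≤ b/(2t)` for all `t > 0`
    rw [zero_mul, Real.sqrt_zero]
    refine le_of_forall_pos_le_add fun ε hε => ?_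
    have ht : 0 < (b + 1) / ε := by positivity
    refine (h _ ht).trans ?_
    rw [mul_zero, zero_add, div_div_eq_mul_div]
    have : b * ε / (b + 1) / 2 ≤ ε := by
      rw [div_le_iff₀ (by norm_num : (0:ℝ) < 2), div_le_iff₀ (by linarith)]
      nlinarith
    linarith
  rcases hb.eq_or_lt with rfl | hb'
  · -- `b = 0`: `x ≤ t·a/2` for all `t > 0`
    rw [mul_zero, Real.sqrt_zero]
    refine le_of_forall_pos_le_add fun ε hε => ?_
    have ht : 0 < ε / a := by positivity
    refine (h _ ht).trans ?_
    rw [zero_div, add_zero, div_mul_cancel₀ _ ha'.ne']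
    linarith
  · -- `a, b > 0`: `t = √b/√a`
    have hsa := Real.sqrt_pos.2 ha'
    have hsb := Real.sqrt_pos.2 hb'
    have ht : 0 < Real.sqrt b / Real.sqrt a := by positivity
    refine (h _ ht).trans (le_of_eq ?_)
    rw [Real.sqrt_mul ha]
    have ea := Real.sq_sqrt ha
    have eb := Real.sq_sqrt hb
    field_simp
    nlinarith [ea, eb]

section CS

variable {g : EuclideanSpace ℝ (Fin 2) → ℂ} (hper : Torus.IsLatticePeriodic g)

omit [NeZero L] in
/-- **`far₁ ≤ √(far₀·far₂)`**: for a nonnegative lattice weight `P` (e.g. the far indicator) with `P·‖a‖²` and `P·(z₀²+z₁²)·‖a‖²` summable,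
`Σ_z P(z)·√(z₀²+z₁²)·‖a(z)‖² ≤ √(Σ_z P‖a‖²)·√(Σ_z P(z₀²+z₁²)‖a‖²)` — the `k = 1` certificate is `D₁ := √(D₀D₂)`. -/
theorem tsum_far_weightOne_le_sqrt {P : Site 2 → ℝ} (hP : ∀ z, 0 ≤ P z)
    (hs0 : Summable fun z : Site 2 => P z * ‖mFourierCoeff (Torus.descend g hper) (-z)‖ ^ 2)
    (hs2 : Summable fun z : Site 2 => P z * ((((z 0 : ℤ) : ℝ)) ^ 2 + (((z 1 : ℤ) : ℝ)) ^ 2) * ‖mFourierCoeff (Torus.descend g hper) (-z)‖ ^ 2)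
    {D₀ D₂ : ℝ} (hD0 : ∑' z : Site 2, P z * ‖mFourierCoeff (Torus.descend g hper) (-z)‖ ^ 2 ≤ D₀)
    (hD2 : ∑' z : Site 2, P z * ((((z 0 : ℤ) : ℝ)) ^ 2 + (((z 1 : ℤ) : ℝ)) ^ 2) * ‖mFourierCoeff (Torus.descend g hper) (-z)‖ ^ 2 ≤ D₂) :
    (Summable fun z : Site 2 => P z * Real.sqrt ((((z 0 : ℤ) : ℝ)) ^ 2 + (((z 1 : ℤ) : ℝ)) ^ 2) * ‖mFourierCoeff (Torus.descend g hper) (-z)‖ ^ 2) ∧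
    ∑' z : Site 2, P z * Real.sqrt ((((z 0 : ℤ) : ℝ)) ^ 2 + (((z 1 : ℤ) : ℝ)) ^ 2) * ‖mFourierCoeff (Torus.descend g hper) (-z)‖ ^ 2 ≤
      Real.sqrt (D₀ * D₂) := by
  set f : Site 2 → ℝ := fun z => ‖mFourierCoeff (Torus.descend g hper) (-z)‖ ^ 2 with hf
  set r : Site 2 → ℝ := fun z => (((z 0 : ℤ) : ℝ)) ^ 2 + (((z 1 : ℤ) : ℝ)) ^ 2 with hr
  have hf0 : ∀ z, 0 ≤ f z := fun z => by positivity
  have hr0 : ∀ z, 0 ≤ r z := fun z => by positivity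
  have hD00 : 0 ≤ D₀ := le_trans (tsum_nonneg fun z => mul_nonneg (hP z) (hf0 z)) hD0
  have hD20 : 0 ≤ D₂ := le_trans (tsum_nonneg fun z => mul_nonneg (mul_nonneg (hP z) (hr0 z)) (hf0 z)) hD2
  -- for every `t > 0`: termwise AM–GM
  have hmaj : ∀ t : ℝ, 0 < t → ∀ z, P z * Real.sqrt (r z) * f z ≤ (t * (P z * f z) + (P z * r z * f z) / t) / 2 := by
    intro t ht z
    have h := sqrt_le_half_add_div (hr0 z) ht
    have hPf : 0 ≤ P z * f z := mul_nonneg (hP z) (hf0 z)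
    calc P z * Real.sqrt (r z) * f z = (P z * f z) * Real.sqrt (r z) := by ring
      _ ≤ (P z * f z) * ((t + r z / t) / 2) := mul_le_mul_of_nonneg_left h hPf
      _ = (t * (P z * f z) + (P z * r z * f z) / t) / 2 := by ring
  have hsum1 : Summable fun z : Site 2 => P z * Real.sqrt (r z) * f z := by
    refine Summable.of_nonneg_of_le (fun z => mul_nonneg (mul_nonneg (hP z) (Real.sqrt_nonneg _)) (hf0 z)) (hmaj 1 one_pos) ?_
    simp only [one_mul, div_one]
    exact (hs0.add hs2).div_const 2
  refine ⟨hsum1, le_sqrt_mul_of_forall_pos hD00 hD20 fun t ht => ?_⟩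
  have hmajS : Summable fun z : Site 2 => (t * (P z * f z) + (P z * r z * f z) / t) / 2 :=
    ((hs0.mul_left t).add (hs2.div_const t)).div_const 2
  calc ∑' z, P z * Real.sqrt (r z) * f z ≤ ∑' z, (t * (P z * f z) + (P z * r z * f z) / t) / 2 :=
        hsum1.tsum_le_tsum (hmaj t ht) hmajS
    _ = (t * ∑' z, P z * f z + (∑' z, P z * r z * f z) / t) / 2 := by
        rw [tsum_div_const, (hs0.mul_left t).tsum_add (hs2.div_const t), tsum_mul_left, tsum_div_const]
    _ ≤ (t * D₀ + D₂ / t) / 2 := by gcongr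

end CS

/-! ## §5 The bare-frame scale-`0` symbol: the `hΦ` of `farRows_le_of_l2Far` from the far lattice sum, images constant hypothesis-free -/

section Bare

/-- The far weight of row `k` on `ℤ²`: `[z ≠ 0 ∧ z ∉ disk]·√(z₀²+z₁²)ᵏ` is nonnegative and `≤ 1 + (z₀²+z₁²)` for `k ≤ 2` (so its lattice sums against
`‖a‖²` are summable by the two Parseval identities). -/
theorem farWeight_nonneg_le (c : SunsetCellRecordV2) (k : Fin 3) (z : Site 2) :
    0 ≤ (if z ≠ 0 ∧ z ∉ c.disk then Real.sqrt ((((z 0 : ℤ) : ℝ)) ^ 2 + (((z 1 : ℤ) : ℝ)) ^ 2) ^ (k : ℕ) else 0) ∧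
    (if z ≠ 0 ∧ z ∉ c.disk then Real.sqrt ((((z 0 : ℤ) : ℝ)) ^ 2 + (((z 1 : ℤ) : ℝ)) ^ 2) ^ (k : ℕ) else 0) ≤
      1 + ((((z 0 : ℤ) : ℝ)) ^ 2 + (((z 1 : ℤ) : ℝ)) ^ 2) := by
  set r : ℝ := (((z 0 : ℤ) : ℝ)) ^ 2 + (((z 1 : ℤ) : ℝ)) ^ 2 with hr
  have hr0 : 0 ≤ r := by positivity
  refine ⟨by split_ifs <;> positivity, ?_⟩
  split_ifs
  · have hk : (k : ℕ) = 0 ∨ (k : ℕ) = 1 ∨ (k : ℕ) = 2 := by have := k.isLt; omega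
    rcases hk with hk | hk | hk <;> rw [hk]
    · rw [pow_zero]; linarith
    · rw [pow_one]
      have h := sqrt_le_half_add_div hr0 one_pos
      rw [div_one] at h
      linarith
    · rw [Real.sq_sqrt hr0]; linarith
  · positivity

variable (μ : ℝ) {om : ℝ}

/-- **Images tail of the bare-frame scale-`0` kernel, hypothesis-free**: for `ω ≠ 0`, `K ≥ 4`, `L ≥ 1` and every centred `z` (`2‖z‖∞ ≤ L`),
`Σ_{n ≠ 0} ‖a_ω(z + Ln)‖ ≤ (C_K(ω)/π^K)·(4/L)ᴷ·S_K`, `C_K(ω) = K!·klChi2CauchyTab K·(K+1)!·(2/m)²·max(1,2/m)^{K−1}·(8π)ᴷ`, `m = max(|ω|, klE0/2)`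
(table-free bare jets `norm_iteratedFDeriv_uvSpatialSymbol_bare_le_of_one_le_tab` ⇒ off-site coefficient decay `norm_mFourierCoeff_descend_le_inv_pow_of_ne_zero`
⇒ `images_tail_le_of_decay`). -/
theorem images_tail_bare_le (hom : om ≠ 0) {K : ℕ} (hK : 2 * 2 ≤ K) {z : Site 2} (hz : 2 * ‖z‖ ≤ L) :
    ∑' n : Site 2, (if n = 0 then 0 else ‖mFourierCoeff (Torus.descend (fun y : Momentum => uvSymbolFn 1 klE0 (frameLevel μ 0 ((2 * π) • y)) om)
        (uvSpatialSymbol_isLatticePeriodic 1 klE0 μ 0 om)) (-(z + (L : ℤ) • n))‖) ≤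
      (K ! * (1 * klChi2CauchyTab K * (K + 1)! * (2 / max |om| (klE0 / 2)) ^ 2 * (max 1 (2 / max |om| (klE0 / 2))) ^ (K - 1)) * ((2 * π) * 4) ^ K) /
          Real.pi ^ K * (4 / (L : ℝ)) ^ K * ∑' n : Site 2, ((1 + ‖n‖) ^ K)⁻¹ := by
  have hE0 : (0 : ℝ) < klE0 := by norm_num [klE0]
  have hK1 : 1 ≤ K := le_trans (by norm_num) hK
  have hL : 1 ≤ L := Nat.one_le_iff_ne_zero.2 (NeZero.ne L)
  have hjet := norm_iteratedFDeriv_uvSpatialSymbol_bare_le_of_one_le_tab (c := (1:ℝ)) zero_le_one hE0 μ om hK1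
  have hdec : ∀ k : Site 2, k ≠ 0 → ‖mFourierCoeff (Torus.descend (fun y : Momentum => uvSymbolFn 1 klE0 (frameLevel μ 0 ((2 * π) • y)) om)
      (uvSpatialSymbol_isLatticePeriodic 1 klE0 μ 0 om)) k‖ ≤
      (K ! * (1 * klChi2CauchyTab K * (K + 1)! * (2 / max |om| (klE0 / 2)) ^ 2 * (max 1 (2 / max |om| (klE0 / 2))) ^ (K - 1)) * ((2 * π) * 4) ^ K) /
          Real.pi ^ K * ((1 + ‖k‖) ^ K)⁻¹ :=
    fun k hk => norm_mFourierCoeff_descend_le_inv_pow_of_ne_zero (uvSpatialSymbol_isLatticePeriodic 1 klE0 μ 0 om)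
      (uvSpatialSymbol_contDiff 1 μ 0 hom) hjet hk
  have hC0 : 0 ≤ (K ! * (1 * klChi2CauchyTab K * (K + 1)! * (2 / max |om| (klE0 / 2)) ^ 2 * (max 1 (2 / max |om| (klE0 / 2))) ^ (K - 1)) *
      ((2 * π) * 4) ^ K) / Real.pi ^ K := by
    have := (one_le_klChi2CauchyTab K)
    positivity
  exact images_tail_le_of_decay (uvSpatialSymbol_isLatticePeriodic 1 klE0 μ 0 om) hC0 hK hdec hL hz

/-- **LOW-SHELL FAR ℓ² FROM THE FAR LATTICE SUM, abstract images bound** (bare frame `Ψ¹`, `Λ = klE0`, `K = 0`; `ω ≠ 0`; row `k : Fin 3`; record `c` — only its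
disk matters): if the far lattice sum of the infinite-volume kernel is `≤ D` and the images tail on centred sites is `≤ τ`, then the `hΦ`-summand of
`farRows_le_of_l2Far` at frequency `ω` is `≤ (√D + √(L^{k+2})·τ)²`. -/
theorem l2Far_low_of_farLattice_of_images (c : SunsetCellRecordV2) (hom : om ≠ 0) (k : Fin 3) {D : ℝ}
    (hD : ∑' z : Site 2, (if z ≠ 0 ∧ z ∉ c.disk then Real.sqrt ((((z 0 : ℤ) : ℝ)) ^ 2 + (((z 1 : ℤ) : ℝ)) ^ 2) ^ (k : ℕ) else 0) *
        ‖mFourierCoeff (Torus.descend (fun y : Momentum => uvSymbolFn 1 klE0 (frameLevel μ 0 ((2 * π) • y)) om)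
          (uvSpatialSymbol_isLatticePeriodic 1 klE0 μ 0 om)) (-z)‖ ^ 2 ≤ D)
    {τ : ℝ} (hτ0 : 0 ≤ τ)
    (hτ : ∀ z : Site 2, 2 * ‖z‖ ≤ L →
      ∑' n : Site 2, (if n = 0 then 0 else ‖mFourierCoeff (Torus.descend (fun y : Momentum => uvSymbolFn 1 klE0 (frameLevel μ 0 ((2 * π) • y)) om)
        (uvSpatialSymbol_isLatticePeriodic 1 klE0 μ 0 om)) (-(z + (L : ℤ) • n))‖) ≤ τ) :
    ∑ u : TorusSite 2 L,
      (if u ≠ 0 ∧ (fun j => (u j).valMinAbs : Site 2) ∉ c.disk then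
        Real.sqrt ((((u 0).valMinAbs.natAbs : ℝ)) ^ 2 + (((u 1).valMinAbs.natAbs : ℝ)) ^ 2) ^ (k : ℕ) *
          ‖torusFourierInv (fun kv : TorusSite 2 L =>
            (fun y : Momentum => uvSymbolFn 1 klE0 (frameLevel μ 0 ((2 * π) • y)) om)
              (WithLp.toLp 2 fun j => ((kv j).val : ℝ) / L)) u‖ ^ 2
        else 0) ≤
      (Real.sqrt D + Real.sqrt ((L : ℝ) ^ ((k : ℕ) + 2)) * τ) ^ 2 := by
  classical
  set g : Momentum → ℂ := fun y : Momentum => uvSymbolFn 1 klE0 (frameLevel μ 0 ((2 * π) • y)) om with hg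
  have hper : Torus.IsLatticePeriodic g := uvSpatialSymbol_isLatticePeriodic 1 klE0 μ 0 om
  have hs : ContDiff ℝ (⊤ : ℕ∞) g := uvSpatialSymbol_contDiff 1 μ 0 hom
  set W : Site 2 → ℝ := fun z => if z ≠ 0 ∧ z ∉ c.disk then Real.sqrt ((((z 0 : ℤ) : ℝ)) ^ 2 + (((z 1 : ℤ) : ℝ)) ^ 2) ^ (k : ℕ) else 0 with hW
  have hW0 : ∀ z, 0 ≤ W z := fun z => (farWeight_nonneg_le c k z).1
  -- summability of `W‖a‖²` from the two Parseval identities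
  have hWs : Summable fun z : Site 2 => W z * ‖mFourierCoeff (Torus.descend g hper) (-z)‖ ^ 2 := by
    have h0 := (hasSum_normSq_kernel hper hs).summable
    have h2 := (hasSum_sqNorm_mul_normSq_kernel hper hs).summable
    refine Summable.of_nonneg_of_le (fun z => mul_nonneg (hW0 z) (sq_nonneg _)) (fun z => ?_) (h0.add h2)
    have h := (farWeight_nonneg_le c k z).2
    calc W z * ‖mFourierCoeff (Torus.descend g hper) (-z)‖ ^ 2 ≤ (1 + ((((z 0 : ℤ) : ℝ)) ^ 2 + (((z 1 : ℤ) : ℝ)) ^ 2)) *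
          ‖mFourierCoeff (Torus.descend g hper) (-z)‖ ^ 2 := mul_le_mul_of_nonneg_right h (sq_nonneg _)
      _ = _ := by ring
  have hmain := sum_weight_normSq_torusFourierInv_le (L := L) hper hs W hW0 hWs hD hτ0 hτ
  -- centred representatives
  set zc : TorusSite 2 L → Site 2 := fun u => fun j => (u j).valMinAbs with hzc
  have hproj : ∀ u : TorusSite 2 L, Torus.proj L (zc u) = u := fun u => (two_mul_norm_valMinAbs_le u).1
  have hzcL : ∀ u : TorusSite 2 L, 2 * ‖zc u‖ ≤ L := fun u => (two_mul_norm_valMinAbs_le u).2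
  have hzc0 : ∀ u : TorusSite 2 L, u ≠ 0 ↔ zc u ≠ 0 := by
    intro u
    refine ⟨fun hu h0 => hu ?_, fun hz hu => hz ?_⟩
    · have h := hproj u
      rw [h0] at h
      have : Torus.proj L (0 : Site 2) = 0 := by funext j; simp [Literature.Probability.LatticeModels.Torus.proj_apply]
      rw [this] at h
      exact h.symm
    · funext j; simp [hzc, hu]
  -- the torus-side summand IS `W(ũ)·‖TFI(u)‖²`
  have hsummand : ∀ u : TorusSite 2 L,
      (if u ≠ 0 ∧ (fun j => (u j).valMinAbs : Site 2) ∉ c.disk then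
        Real.sqrt ((((u 0).valMinAbs.natAbs : ℝ)) ^ 2 + (((u 1).valMinAbs.natAbs : ℝ)) ^ 2) ^ (k : ℕ) *
          ‖torusFourierInv (fun kv : TorusSite 2 L => g (WithLp.toLp 2 fun j => ((kv j).val : ℝ) / L)) u‖ ^ 2
        else 0) = W (zc u) * ‖torusFourierInv (fun kv : TorusSite 2 L => g (WithLp.toLp 2 fun j => ((kv j).val : ℝ) / L)) u‖ ^ 2 := by
    intro u
    have hwt : Real.sqrt ((((u 0).valMinAbs.natAbs : ℝ)) ^ 2 + (((u 1).valMinAbs.natAbs : ℝ)) ^ 2) =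
        Real.sqrt ((((zc u 0 : ℤ) : ℝ)) ^ 2 + (((zc u 1 : ℤ) : ℝ)) ^ 2) := by
      simp only [hzc, Nat.cast_natAbs, Int.cast_abs, sq_abs]
    by_cases hcond : u ≠ 0 ∧ (fun j => (u j).valMinAbs : Site 2) ∉ c.disk
    · have hcond' : zc u ≠ 0 ∧ zc u ∉ c.disk := ⟨(hzc0 u).1 hcond.1, hcond.2⟩
      rw [if_pos hcond, hwt]
      simp only [hW]
      rw [if_pos hcond']
    · have hcond' : ¬ (zc u ≠ 0 ∧ zc u ∉ c.disk) := fun h => hcond ⟨(hzc0 u).2 h.1, h.2⟩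
      rw [if_neg hcond]
      simp only [hW]
      rw [if_neg hcond', zero_mul]
  simp_rw [hsummand]
  refine hmain.trans ?_
  -- `Σ_u W(ũ) ≤ L^{k+2}`
  have hL1 : (1 : ℝ) ≤ L := by exact_mod_cast Nat.one_le_iff_ne_zero.2 (NeZero.ne L)
  have hWle : ∀ u : TorusSite 2 L, W (zc u) ≤ (L : ℝ) ^ (k : ℕ) := by
    intro u
    simp only [hW]
    split_ifs
    · refine pow_le_pow_left₀ (Real.sqrt_nonneg _) ?_ _
      have h1 := sqrt_natAbs_sq_le (zc u)
      have h1' : Real.sqrt ((((zc u 0 : ℤ) : ℝ)) ^ 2 + (((zc u 1 : ℤ) : ℝ)) ^ 2) ≤ Real.sqrt 2 * ‖zc u‖ := by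
        have ha : |((zc u 0 : ℤ) : ℝ)| ≤ ‖zc u‖ := by
          rw [← Int.norm_eq_abs, ← Int.norm_cast_real]; exact norm_le_pi_norm (zc u) 0
        have hb : |((zc u 1 : ℤ) : ℝ)| ≤ ‖zc u‖ := by
          rw [← Int.norm_eq_abs, ← Int.norm_cast_real]; exact norm_le_pi_norm (zc u) 1
        have hn := norm_nonneg (zc u)
        calc Real.sqrt ((((zc u 0 : ℤ) : ℝ)) ^ 2 + (((zc u 1 : ℤ) : ℝ)) ^ 2) ≤ Real.sqrt (2 * ‖zc u‖ ^ 2) := by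
              refine Real.sqrt_le_sqrt ?_
              nlinarith [sq_abs (((zc u 0 : ℤ) : ℝ)), sq_abs (((zc u 1 : ℤ) : ℝ)), abs_nonneg (((zc u 0 : ℤ) : ℝ)),
                abs_nonneg (((zc u 1 : ℤ) : ℝ))]
          _ = Real.sqrt 2 * ‖zc u‖ := by rw [Real.sqrt_mul (by norm_num), Real.sqrt_sq hn]
      have hs2 : Real.sqrt 2 ≤ 2 := by
        rw [show (2:ℝ) = Real.sqrt 4 by rw [show (4:ℝ) = 2^2 by norm_num, Real.sqrt_sq (by norm_num)]]
        exact Real.sqrt_le_sqrt (by norm_num)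
      have := hzcL u
      nlinarith [norm_nonneg (zc u), Real.sqrt_nonneg 2]
    · positivity
  have hcard : (Finset.univ : Finset (TorusSite 2 L)).card = L ^ 2 := by
    rw [Finset.card_univ]; simp [TorusSite, ZMod.card]
  have hsumW : ∑ u : TorusSite 2 L, W (zc u) ≤ (L : ℝ) ^ ((k : ℕ) + 2) := by
    calc ∑ u : TorusSite 2 L, W (zc u) ≤ ∑ _u : TorusSite 2 L, (L : ℝ) ^ (k : ℕ) := Finset.sum_le_sum fun u _ => hWle u
      _ = (L : ℝ) ^ ((k : ℕ) + 2) := by rw [Finset.sum_const, hcard, nsmul_eq_mul]; push_cast; ring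
  have hD0 : 0 ≤ Real.sqrt D := Real.sqrt_nonneg _
  have h1 : Real.sqrt (∑ u : TorusSite 2 L, W (zc u)) * τ ≤ Real.sqrt ((L : ℝ) ^ ((k : ℕ) + 2)) * τ :=
    mul_le_mul_of_nonneg_right (Real.sqrt_le_sqrt hsumW) hτ0
  have h0 : 0 ≤ Real.sqrt D + Real.sqrt (∑ u : TorusSite 2 L, W (zc u)) * τ := by positivity
  exact pow_le_pow_left₀ h0 (by linarith) 2

/-- **LOW-SHELL FAR ℓ² FROM THE FAR LATTICE SUM** (bare frame `Ψ¹`, `Λ = klE0`, `K = 0`; `ω ≠ 0`; row `k : Fin 3`; `K ≥ 4` the images order): in EXACTLY the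
`hΦ` shape of `…SunsetFarRowsL2.farRows_le_of_l2Far` at frequency `ω`,
`Σ_{u ≠ 0, ũ ∉ disk} √(ũ₀²+ũ₁²)ᵏ·‖TFI_ω(u)‖² ≤ (√D + √(L^{k+2})·(C_K(ω)/π^K)·(4/L)ᴷ·S_K)²`
where `D` bounds the FAR LATTICE SUM `Σ_{z ≠ 0, z ∉ disk} √(z₀²+z₁²)ᵏ·‖a_ω(z)‖²` of the infinite-volume kernel `a_ω(z) = 𝓕(g_ω♭)(−z)` (the certificate's
object: by §3 it equals the Parseval total minus the near sum, `k = 1` via `tsum_far_weightOne_le_sqrt`), and the images constant is hypothesis-free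
(`images_tail_bare_le`; `S_K = Σ_{n ∈ ℤ²}(1+‖n‖∞)^{−K}`). -/
theorem l2Far_low_of_farLattice (c : SunsetCellRecordV2) (hom : om ≠ 0) (k : Fin 3) {D : ℝ}
    (hD : ∑' z : Site 2, (if z ≠ 0 ∧ z ∉ c.disk then Real.sqrt ((((z 0 : ℤ) : ℝ)) ^ 2 + (((z 1 : ℤ) : ℝ)) ^ 2) ^ (k : ℕ) else 0) *
        ‖mFourierCoeff (Torus.descend (fun y : Momentum => uvSymbolFn 1 klE0 (frameLevel μ 0 ((2 * π) • y)) om)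
          (uvSpatialSymbol_isLatticePeriodic 1 klE0 μ 0 om)) (-z)‖ ^ 2 ≤ D)
    {K : ℕ} (hK : 2 * 2 ≤ K) :
    ∑ u : TorusSite 2 L,
      (if u ≠ 0 ∧ (fun j => (u j).valMinAbs : Site 2) ∉ c.disk then
        Real.sqrt ((((u 0).valMinAbs.natAbs : ℝ)) ^ 2 + (((u 1).valMinAbs.natAbs : ℝ)) ^ 2) ^ (k : ℕ) *
          ‖torusFourierInv (fun kv : TorusSite 2 L =>
            (fun y : Momentum => uvSymbolFn 1 klE0 (frameLevel μ 0 ((2 * π) • y)) om)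
              (WithLp.toLp 2 fun j => ((kv j).val : ℝ) / L)) u‖ ^ 2
        else 0) ≤
      (Real.sqrt D + Real.sqrt ((L : ℝ) ^ ((k : ℕ) + 2)) *
        ((K ! * (1 * klChi2CauchyTab K * (K + 1)! * (2 / max |om| (klE0 / 2)) ^ 2 * (max 1 (2 / max |om| (klE0 / 2))) ^ (K - 1)) * ((2 * π) * 4) ^ K) /
          Real.pi ^ K * (4 / (L : ℝ)) ^ K * ∑' n : Site 2, ((1 + ‖n‖) ^ K)⁻¹)) ^ 2 := by
  have hτ0 : 0 ≤ (K ! * (1 * klChi2CauchyTab K * (K + 1)! * (2 / max |om| (klE0 / 2)) ^ 2 * (max 1 (2 / max |om| (klE0 / 2))) ^ (K - 1)) *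
      ((2 * π) * 4) ^ K) / Real.pi ^ K * (4 / (L : ℝ)) ^ K * ∑' n : Site 2, ((1 + ‖n‖) ^ K)⁻¹ := by
    have := one_le_klChi2CauchyTab K
    have hS : 0 ≤ ∑' n : Site 2, ((1 + ‖n‖) ^ K)⁻¹ := tsum_nonneg fun n => by positivity
    positivity
  exact l2Far_low_of_farLattice_of_images (L := L) μ c hom k hD hτ0 (fun z hz => images_tail_bare_le (L := L) μ hom hK hz)

end Bare

end Summit.HubbardSuperconductivity.HubbardSuperconductivity.Theorems.KLRegimeSplit

end
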